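import Mathlib
import HarnessLib
import Summits.Ventures.LatticeQCDFlow.Scoring.ChainEDFBand

/-!
# Two exact samplers whose stationary laws of the statistic DIFFER are told apart: if
# `|F_A(t₀) − F_B(t₀)| = Δ` at some point, the two printed distribution functions (two Doeblin
# chains, independent runs, any starts) differ by MORE than `Δ − η` somewhere, except with
# probability at most the sum of the two one-chain band failures at accuracy `η/2`

HONEST FRAMING: exact (Metropolis-corrected) sampling algorithms for lattice gauge theory;
figures of merit are autocorrelation/cost numbers at stated couplings and volumes; no
continuum-physics claim.

Venture `LatticeQCDFlow` (cell pub-lqcd), topic `Scoring`; FANOUT row 4 (`s0-u1-b`, rung S0-B: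
implementation A versus implementation B).  `Scoring/ChainTwoSampleEDFBand` is the null side of
the two-chain comparison (same stationary law ⇒ the printed curves agree uniformly within `η`).
This file is the POWER side: if the two stationary distribution functions differ by `Δ` at a
point `t₀`, then outside the two one-chain band events of `Scoring/ChainEDFBand` (accuracy `η/2`
each, any starts) the printed curves differ at `t₀` by more than `Δ − η` (triangle inequality), so
**`chain_measureReal_forall_twoSample_edf_lt_le`**:
`(P_A ⊗ P_B)(∀ t, |F̂^A_N(t) − F̂^B_M(t)| < |F_A(t₀) − F_B(t₀)| − η)
   ≤ 2(⌈4/η⌉ + 1)·(exp(−(Nη − 32/ε_A)²/(512N/ε_A²)) + exp(−(Mη − 32/ε_B)²/(512M/ε_B²)))`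
(`Nη ≥ 32/ε_A`, `Mη ≥ 32/ε_B`).  Read with `η < Δ/2`: a uniform-distance test at threshold `Δ/2`
separates the two implementations with the displayed error probabilities under both hypotheses.
NEW WORK of the cell (not a published result); no definition is introduced.

## Content

* **`chain_measureReal_forall_twoSample_edf_lt_le`**.

NOT CLAIMED: any `ε` for a concrete sampler; the Kolmogorov–Smirnov limit laws; optimal constants.
-/

noncomputable section

namespace Summit.Ventures.LatticeQCDFlow.Scoring.GlivenkoCantelli

open MeasureTheory ProbabilityTheory Finset Filter Function
open scoped Topology ENNReal

variable {ΩA : Type*} [MeasurableSpace ΩA] {κA : Kernel ΩA ΩA} [IsMarkovKernel κA]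
  {μA : Measure ΩA} [IsProbabilityMeasure μA] {πA : Measure ΩA} [IsProbabilityMeasure πA]
variable {ΩB : Type*} [MeasurableSpace ΩB] {κB : Kernel ΩB ΩB} [IsMarkovKernel κB]
  {μB : Measure ΩB} [IsProbabilityMeasure μB] {πB : Measure ΩB} [IsProbabilityMeasure πB]

/-- **DIFFERENT STATIONARY LAWS ARE DETECTED BY THE PRINTED DISTRIBUTION FUNCTIONS.**  `π_A`
invariant for `κ_A` with `κ_A(x, ·) ≥ ε_A π_A`, `π_B` invariant for `κ_B` with `κ_B(y, ·) ≥ ε_B π_B`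
(`ε_A, ε_B > 0`); measurable real statistics `O_A`, `O_B` with stationary distribution functions
`F_A`, `F_B`; a point `t₀`; independent runs from arbitrary initial laws; `η > 0`, `N, M ≠ 0`,
`Nη ≥ 32/ε_A`, `Mη ≥ 32/ε_B`.  Then
`(P_A ⊗ P_B)(∀ t, |#{i<N : O_A(X_i) ≤ t}/N − #{j<M : O_B(Y_j) ≤ t}/M| < |F_A(t₀) − F_B(t₀)| − η)
   ≤ 2(⌈4/η⌉ + 1)·(exp(−(Nη − 32/ε_A)²/(512N/ε_A²)) + exp(−(Mη − 32/ε_B)²/(512M/ε_B²)))`. [ours] -/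
theorem chain_measureReal_forall_twoSample_edf_lt_le
    (hπA : Kernel.Invariant κA πA) {εA : ℝ≥0∞}
    (hminA : ∀ x {B : Set ΩA}, MeasurableSet B → εA * πA B ≤ κA x B) (hεA : 0 < εA)
    {OA : ΩA → ℝ} (hOA : Measurable OA)
    (hπB : Kernel.Invariant κB πB) {εB : ℝ≥0∞}
    (hminB : ∀ y {B : Set ΩB}, MeasurableSet B → εB * πB B ≤ κB y B) (hεB : 0 < εB)
    {OB : ΩB → ℝ} (hOB : Measurable OB) (t₀ : ℝ)
    {η : ℝ} (hη : 0 < η) {N M : ℕ} (hN : N ≠ 0) (hM : M ≠ 0)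
    (hNη : 32 / εA.toReal ≤ N * η) (hMη : 32 / εB.toReal ≤ M * η) :
    ((Kernel.trajMeasure (X := fun _ : ℕ => ΩA) μA
          (fun m : ℕ => κA.comap
            (fun y : (i : ↥(Finset.Iic m)) → ΩA => y ⟨m, Finset.mem_Iic.2 le_rfl⟩)
            (measurable_pi_apply _))).prod
      (Kernel.trajMeasure (X := fun _ : ℕ => ΩB) μB
          (fun m : ℕ => κB.comap
            (fun y : (i : ↥(Finset.Iic m)) → ΩB => y ⟨m, Finset.mem_Iic.2 le_rfl⟩)
            (measurable_pi_apply _)))).real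
        {ω : (ℕ → ΩA) × (ℕ → ΩB) | ∀ t : ℝ,
          |(∑ i ∈ range N, (Set.Iic t).indicator (1 : ℝ → ℝ) (OA (ω.1 i))) / N
            - (∑ j ∈ range M, (Set.Iic t).indicator (1 : ℝ → ℝ) (OB (ω.2 j))) / M|
            < |cdf (πA.map OA) t₀ - cdf (πB.map OB) t₀| - η}
      ≤ 2 * ((⌈4 / η⌉₊ : ℝ) + 1)
          * (Real.exp (-(N * η - 32 / εA.toReal) ^ 2 / (512 * N / εA.toReal ^ 2))
            + Real.exp (-(M * η - 32 / εB.toReal) ^ 2 / (512 * M / εB.toReal ^ 2))) := by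
  set PA := Kernel.trajMeasure (X := fun _ : ℕ => ΩA) μA
      (fun m : ℕ => κA.comap (fun y : (i : ↥(Finset.Iic m)) → ΩA => y ⟨m, Finset.mem_Iic.2 le_rfl⟩)
        (measurable_pi_apply _)) with hPA
  set PB := Kernel.trajMeasure (X := fun _ : ℕ => ΩB) μB
      (fun m : ℕ => κB.comap (fun y : (i : ↥(Finset.Iic m)) → ΩB => y ⟨m, Finset.mem_Iic.2 le_rfl⟩)
        (measurable_pi_apply _)) with hPB
  have hη2 : 0 < η / 2 := half_pos hη
  have hNη' : 16 / εA.toReal ≤ N * (η / 2) := by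
    have : (32 : ℝ) / εA.toReal = 2 * (16 / εA.toReal) := by ring
    linarith
  have hMη' : 16 / εB.toReal ≤ M * (η / 2) := by
    have : (32 : ℝ) / εB.toReal = 2 * (16 / εB.toReal) := by ring
    linarith
  have hA := chain_measureReal_exists_edf_dev_ge_le_of_pos (μ₀ := μA) hπA hminA hεA hOA hN hη2 hNη'
  have hB := chain_measureReal_exists_edf_dev_ge_le_of_pos (μ₀ := μB) hπB hminB hεB hOB hM hη2 hMη'
  rw [← hPA] at hA
  rw [← hPB] at hB
  have e4 : (2 : ℝ) / (η / 2) = 4 / η := by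
    field_simp
    ring
  rw [e4] at hA hB
  -- the one-run deviation events
  set SA : Set (ℕ → ΩA) := {x | ∃ t : ℝ, η / 2 ≤ |cdf (πA.map OA) t
    - (∑ i ∈ range N, (Set.Iic t).indicator (1 : ℝ → ℝ) (OA (x i))) / N|} with hSA
  set SB : Set (ℕ → ΩB) := {y | ∃ t : ℝ, η / 2 ≤ |cdf (πB.map OB) t
    - (∑ j ∈ range M, (Set.Iic t).indicator (1 : ℝ → ℝ) (OB (y j))) / M|} with hSB
  have hsub : {ω : (ℕ → ΩA) × (ℕ → ΩB) | ∀ t : ℝ,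
      |(∑ i ∈ range N, (Set.Iic t).indicator (1 : ℝ → ℝ) (OA (ω.1 i))) / N
        - (∑ j ∈ range M, (Set.Iic t).indicator (1 : ℝ → ℝ) (OB (ω.2 j))) / M|
        < |cdf (πA.map OA) t₀ - cdf (πB.map OB) t₀| - η}
      ⊆ SA ×ˢ (Set.univ : Set (ℕ → ΩB)) ∪ (Set.univ : Set (ℕ → ΩA)) ×ˢ SB := by
    intro ω hω
    by_contra hgood
    simp only [Set.mem_union, Set.mem_prod, Set.mem_univ, and_true, true_and, not_or, hSA, hSB,
      Set.mem_setOf_eq, not_exists, not_le] at hgood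
    have h1 := hgood.1 t₀
    have h2 := hgood.2 t₀
    have h3 := hω t₀
    -- triangle inequality at `t₀`
    have htri := abs_sub_le (cdf (πA.map OA) t₀)
      ((∑ i ∈ range N, (Set.Iic t₀).indicator (1 : ℝ → ℝ) (OA (ω.1 i))) / N)
      (cdf (πB.map OB) t₀)
    have htri2 := abs_sub_le ((∑ i ∈ range N, (Set.Iic t₀).indicator (1 : ℝ → ℝ) (OA (ω.1 i))) / N)
      ((∑ j ∈ range M, (Set.Iic t₀).indicator (1 : ℝ → ℝ) (OB (ω.2 j))) / M)
      (cdf (πB.map OB) t₀)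
    rw [abs_sub_comm] at h2
    linarith
  calc (PA.prod PB).real {ω : (ℕ → ΩA) × (ℕ → ΩB) | ∀ t : ℝ,
        |(∑ i ∈ range N, (Set.Iic t).indicator (1 : ℝ → ℝ) (OA (ω.1 i))) / N
          - (∑ j ∈ range M, (Set.Iic t).indicator (1 : ℝ → ℝ) (OB (ω.2 j))) / M|
          < |cdf (πA.map OA) t₀ - cdf (πB.map OB) t₀| - η}
      ≤ (PA.prod PB).real (SA ×ˢ (Set.univ : Set (ℕ → ΩB)) ∪ (Set.univ : Set (ℕ → ΩA)) ×ˢ SB) :=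
        measureReal_mono hsub (measure_ne_top _ _)
    _ ≤ (PA.prod PB).real (SA ×ˢ (Set.univ : Set (ℕ → ΩB)))
        + (PA.prod PB).real ((Set.univ : Set (ℕ → ΩA)) ×ˢ SB) := measureReal_union_le _ _
    _ = PA.real SA + PB.real SB := by
        simp only [measureReal_def, Measure.prod_prod, measure_univ, mul_one, one_mul]
    _ ≤ 2 * ((⌈4 / η⌉₊ : ℝ) + 1)
          * Real.exp (-(N * (η / 2) - 16 / εA.toReal) ^ 2 / (128 * N / εA.toReal ^ 2))
        + 2 * ((⌈4 / η⌉₊ : ℝ) + 1)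
          * Real.exp (-(M * (η / 2) - 16 / εB.toReal) ^ 2 / (128 * M / εB.toReal ^ 2)) :=
        add_le_add hA hB
    _ = 2 * ((⌈4 / η⌉₊ : ℝ) + 1)
          * (Real.exp (-(N * η - 32 / εA.toReal) ^ 2 / (512 * N / εA.toReal ^ 2))
            + Real.exp (-(M * η - 32 / εB.toReal) ^ 2 / (512 * M / εB.toReal ^ 2))) := by
        have en : -((N : ℝ) * (η / 2) - 16 / εA.toReal) ^ 2 / (128 * N / εA.toReal ^ 2)
            = -(N * η - 32 / εA.toReal) ^ 2 / (512 * N / εA.toReal ^ 2) := by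
          obtain ⟨-, -, -, -, -, heA⟩ := half_const_bounds hminA hεA
          have hNr : (0 : ℝ) < N := by exact_mod_cast Nat.pos_of_ne_zero hN
          field_simp
          ring
        have em : -((M : ℝ) * (η / 2) - 16 / εB.toReal) ^ 2 / (128 * M / εB.toReal ^ 2)
            = -(M * η - 32 / εB.toReal) ^ 2 / (512 * M / εB.toReal ^ 2) := by
          obtain ⟨-, -, -, -, -, heB⟩ := half_const_bounds hminB hεB
          have hMr : (0 : ℝ) < M := by exact_mod_cast Nat.pos_of_ne_zero hM
          field_simp
          ring
        rw [en, em]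
        ring

end Summit.Ventures.LatticeQCDFlow.Scoring.GlivenkoCantelli

end
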